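import Literature.NumberTheory.DiophantineGeometry.CatalanPUnitCoordinates
import Literature.NumberTheory.DiophantineGeometry.CatalanPlusRing
import Literature.NumberTheory.DiophantineGeometry.CatalanSelmerCongruence
import Literature.NumberTheory.DiophantineGeometry.CatalanObstruction
import HarnessLib

/-!
# The plus argument in `K`-language, I: cyclotomic coordinates and the ideals `𝓒 ⊇ 𝓒_P`

Bookkeeping for [Schoof2009, Theorem 14.1] ("the filtration `0 ⊂ C^{(q)}E^q/E^q ⊂ CE^q/E^q ⊂ E/E^q`
… with subquotients `E₁, E₂, E₃`") in the explicit language of the coordinate map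
`crd : E → 𝔽_q^{ℤ/g}` of `CatalanPUnitCoordinates` and the ring `A = 𝔽_q[ℤ/g]` of `CatalanPlusRing`,
with `p`-units written as pairs `(ε, m) ↔ ε π^m` (`Catalan.PUnits.punit`):

* `toR (crd ·)` turns Galois translation `σ_{γ^j}` into multiplication by the monomial `[j]`, and the
  "group-ring power" `∏_k σ_{γ^k}(ε π^m)^{f_k}` into multiplication by `f ∈ A` (`mul_toR_crd`);
* **cyclotomic pairs** `(∏_a u_a^{N_a}, ∑ N_a) ↔ ∏_a (ζ^a - 1)^{N_a}` (`u_a = (ζ^a-1)/(ζ-1)`,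
  `Catalan.PUnits.uσ`) are stable under translation and group-ring powers
  (`unitsGal_cycUnit`, `mul_toR_crd_cyc`), so the `A`-span `𝓒` of the coordinates of the `ζ^a - 1`
  consists of coordinates of cyclotomic pairs (`exists_cyc_of_mem_span`), and the set `S_P` of
  coordinates of cyclotomic pairs whose element is a `q`-th power modulo `q²` (the condition `Sel` of
  `CatalanSelmerCongruence`) is already an ideal (`mem_of_mem_span_sel`) — these are
  `CE^q/E^q ⊇ C^{(q)}E^q/E^q` of [Schoof2009, p. 92];
* equal coordinates mean equality up to `q`-th powers of `p`-units (`exists_punit_eq_mul_pow`), and the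
  condition `Sel` passes between integral `p`-units differing by such `q`-th powers
  (`sel_of_punit_eq_mul_pow`).

Everything is a theorem about the parameters `(γ, ε₀, k₀, crd)` / `toR` and their defining properties;
no definition is introduced (D-0026).

## References

* R. Schoof, *Catalan's Conjecture*, Universitext, Springer 2009, Ch. 14, proof of Theorem 14.1
  (book pp. 92–93). [Schoof2009]
-/

namespace Literature.NumberTheory.DiophantineGeometry

namespace Catalan.PlusIdeals

open NumberField NumberField.Units Finset IsCyclotomicExtension
open Literature.NumberTheory.NumberFields.Stickelberger Literature.NumberTheory.NumberFields.UnitGalois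
open Catalan.PUnits Catalan.Minus Catalan.Coord Catalan.PlusRing

set_option backward.isDefEq.respectTransparency false
set_option maxSynthPendingDepth 3

variable {p : ℕ} [hp : Fact p.Prime] {K : Type*} [Field K] [NumberField K]
  [hK : IsCyclotomicExtension {p} ℚ K] {ζ : K} (hζ : IsPrimitiveRoot ζ p)
variable {g : ℕ} [NeZero g] {q : ℕ} [hq : Fact q.Prime]
variable {γ : (ZMod p)ˣ} {ε₀ : (𝓞 K)ˣ} {k₀ : ℤ} {crd : (𝓞 K)ˣ → ℤ → ZMod g → ZMod q}
variable
  (hrep : ∀ (ε : (𝓞 K)ˣ) (m : ℤ), ∃ (ε' : (𝓞 K)ˣ) (m' : ℤ),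
    punit hζ ε m = (∏ k : ZMod g, (gal p K (γ ^ k.val) (punit hζ ε₀ k₀)) ^ (crd ε m k).val) *
      (punit hζ ε' m') ^ q)
  (huniq : ∀ (ε : (𝓞 K)ˣ) (m : ℤ) (c : ZMod g → ℕ) (ε' : (𝓞 K)ˣ) (m' : ℤ),
    punit hζ ε m = (∏ k : ZMod g, (gal p K (γ ^ k.val) (punit hζ ε₀ k₀)) ^ (c k)) *
      (punit hζ ε' m') ^ q → ∀ k, (c k : ZMod q) = crd ε m k)
  (hg : p - 1 = 2 * g) (hγ : ∀ x, x ∈ Subgroup.zpowers γ)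
variable (toR : (ZMod g → ZMod q) → MonoidAlgebra (ZMod q) (Multiplicative (ZMod g)))
  (htoR : ∀ v x, (toR v).coeff x = v (Multiplicative.toAdd x))

/-! ### Coordinates: inverses, differences, products of powers -/

include huniq in
/-- `crd (1, 0) = 0`. [folklore] -/
theorem crd_one_zero : crd 1 0 = 0 :=
  crd_eq_zero_of_eq_pow hζ huniq (ε' := 1) (m' := 0) (by unfold punit; simp)

include hrep huniq in
/-- `crd (ε⁻¹, -m) = - crd (ε, m)`. [folklore] -/
theorem crd_inv (ε : (𝓞 K)ˣ) (m : ℤ) : crd ε⁻¹ (-m) = -crd ε m := by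
  have h := crd_mul hζ hrep huniq ε ε⁻¹ m (-m)
  rw [mul_inv_cancel, add_neg_cancel, crd_one_zero hζ huniq] at h
  exact (neg_eq_of_add_eq_zero_right h.symm).symm

include hrep huniq in
/-- Coordinates of `∏_i T_i^{c_i} π^{∑ c_i m_i}` are `∑ c_i crd(T_i, m_i)`. [folklore] -/
theorem crd_prod_pow {ι : Type*} (s : Finset ι) (T : ι → (𝓞 K)ˣ) (m : ι → ℤ) (c : ι → ℕ) :
    crd (∏ i ∈ s, T i ^ c i) (∑ i ∈ s, (c i : ℤ) * m i) = ∑ i ∈ s, c i • crd (T i) (m i) := by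
  classical
  induction s using Finset.induction_on with
  | empty => rw [Finset.prod_empty, Finset.sum_empty, Finset.sum_empty, crd_one_zero hζ huniq]
  | insert j s hj ih =>
    rw [Finset.prod_insert hj, Finset.sum_insert hj, Finset.sum_insert hj, crd_mul hζ hrep huniq,
      crd_pow hζ hrep huniq, ih]

include hrep huniq in
/-- **Equal coordinates ⟹ equal up to a `q`-th power of a `p`-unit.**
[cite: Schoof2009, Proposition 13.7] -/
theorem exists_punit_eq_mul_pow {ε ε' : (𝓞 K)ˣ} {m m' : ℤ} (h : crd ε m = crd ε' m') :
    ∃ (δ : (𝓞 K)ˣ) (n : ℤ), punit hζ ε m = punit hζ ε' m' * punit hζ δ n ^ q := by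
  have h0 : crd (ε * ε'⁻¹) (m + -m') = 0 := by
    rw [crd_mul hζ hrep huniq, crd_inv hζ hrep huniq, h, add_neg_cancel]
  obtain ⟨δ, n, hδ⟩ := exists_eq_pow_of_crd_eq_zero hζ hrep h0
  refine ⟨δ, n, ?_⟩
  rw [← hδ, ← punit_mul]
  congr 1
  · rw [mul_left_comm, mul_inv_cancel, mul_one]
  · ring

/-! ### Coordinates and the group ring -/

include hrep huniq hg hγ htoR in
/-- **Translation by `σ_{γ^j}` is multiplication by `[j]`** on coordinate vectors.
[cite: Schoof2009, Theorem 14.1 (proof: `E/E^q` as `𝔽_q[G⁺]`-module)] -/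
theorem toR_crd_gal (hp2 : p ≠ 2) (hq2 : q ≠ 2) (hqp : q ≠ p) (j : ℕ) (ε : (𝓞 K)ˣ) (m : ℤ) :
    toR (crd (unitsGal (gal p K (γ ^ j)) ε * uσ hζ (γ ^ j) ^ m) m) =
      MonoidAlgebra.single (Multiplicative.ofAdd (j : ZMod g)) (1 : ZMod q) * toR (crd ε m) := by
  rw [single_mul_toR toR htoR]
  congr 1
  funext k
  exact crd_gal hζ hrep huniq hg hγ hp2 hq2 hqp j ε m k

include hrep huniq hg hγ htoR in
/-- **Group-ring powers**: `f · toR (crd (ε π^m)) = toR (crd (∏_k σ_{γ^k}(ε π^m)^{f_k}))`, the right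
hand side being the `p`-unit with unit part `∏_k (σ_{γ^k}(ε) u_{γ^k}^m)^{f_k}` and `π`-exponent
`∑_k f_k m`. [cite: Schoof2009, Theorem 14.1 (proof)] -/
theorem mul_toR_crd (hp2 : p ≠ 2) (hq2 : q ≠ 2) (hqp : q ≠ p)
    (f : MonoidAlgebra (ZMod q) (Multiplicative (ZMod g))) (ε : (𝓞 K)ˣ) (m : ℤ) :
    f * toR (crd ε m) =
      toR (crd (∏ k : ZMod g, (unitsGal (gal p K (γ ^ k.val)) ε * uσ hζ (γ ^ k.val) ^ m) ^
          (f.coeff (Multiplicative.ofAdd k)).val)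
        (∑ k : ZMod g, ((f.coeff (Multiplicative.ofAdd k)).val : ℤ) * m)) := by
  rw [mul_toR' toR htoR, crd_prod_pow hζ hrep huniq]
  congr 1
  refine Finset.sum_congr rfl fun k _ => ?_
  funext k'
  simp only [Pi.smul_apply]
  rw [crd_gal hζ hrep huniq hg hγ hp2 hq2 hqp k.val ε m k', ZMod.natCast_zmod_val, smul_eq_mul,
    nsmul_eq_mul, ZMod.natCast_zmod_val]

/-! ### Cyclotomic pairs `(∏_a u_a^{N_a}, ∑ N_a)` -/

/-- The `π`-exponent of a cyclotomic pair is invariant under reindexing by `a`. [folklore] -/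
theorem sum_comp_mul_inv (a : (ZMod p)ˣ) (N : (ZMod p)ˣ → ℕ) :
    ∑ c, (N (a⁻¹ * c) : ℤ) = ∑ b, (N b : ℤ) :=
  Fintype.sum_equiv (Equiv.mulLeft a⁻¹) _ _ fun _ => rfl

/-- **Translates of cyclotomic pairs are cyclotomic**:
`σ_a(∏_b u_b^{N_b}) u_a^{∑ N} = ∏_c u_c^{N(a⁻¹c)}` (`u_{ab} = u_a σ_a(u_b)`).
[cite: Schoof2009, Exercise 7.2 and Ch. 14 (`C` is a `ℤ[G]`-module)] -/
theorem unitsGal_cycUnit (a : (ZMod p)ˣ) (N : (ZMod p)ˣ → ℕ) :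
    unitsGal (gal p K a) (∏ b, uσ hζ b ^ N b) * uσ hζ a ^ (∑ b, (N b : ℤ)) =
      ∏ c, uσ hζ c ^ N (a⁻¹ * c) := by
  have h1 : uσ hζ a ^ (∑ b, (N b : ℤ)) = ∏ b, uσ hζ a ^ N b := by
    rw [← Nat.cast_sum, zpow_natCast, Finset.prod_pow_eq_pow_sum]
  rw [h1, map_prod, ← Finset.prod_mul_distrib]
  simp_rw [map_pow, ← mul_pow]
  refine Fintype.prod_equiv (Equiv.mulLeft a) _ _ fun b => ?_
  simp only [Equiv.coe_mulLeft, inv_mul_cancel_left]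
  rw [uσ_mul, mul_comm]

/-- **The element of a cyclotomic pair**: `(∏_a u_a^{N_a}) π^{∑ N_a} = ∏_a σ_a(π)^{N_a} = ∏_a (ζ^a-1)^{N_a}`.
[cite: Schoof2009, Exercise 7.2] -/
theorem cycUnit_mul_pi_pow (N : (ZMod p)ˣ → ℕ) :
    ((∏ a, uσ hζ a ^ N a : (𝓞 K)ˣ) : 𝓞 K) * (hζ.toInteger - 1) ^ (∑ a, N a) =
      ∏ a, (gal p K a • (hζ.toInteger - 1)) ^ N a := by
  simp_rw [gal_smul_pi, mul_pow, Finset.prod_mul_distrib, Finset.prod_pow_eq_pow_sum]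
  push_cast
  rw [mul_comm]

/-- The `K`-form: `punit (∏_a u_a^{N_a}) (∑ N_a) = ∏_a (ζ^a - 1)^{N_a}`. [cite: Schoof2009, Exercise 7.2] -/
theorem punit_cycUnit (N : (ZMod p)ˣ → ℕ) :
    punit hζ (∏ a, uσ hζ a ^ N a) (∑ a, (N a : ℤ)) = ∏ a : (ZMod p)ˣ, (ζ ^ (a : ZMod p).val - 1) ^ N a := by
  have h := congrArg (fun x : 𝓞 K => (x : K)) (cycUnit_mul_pi_pow hζ N)
  unfold punit
  rw [← Nat.cast_sum, zpow_natCast]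
  push_cast at h ⊢
  rw [h]
  refine Finset.prod_congr rfl fun a _ => ?_
  have e : gal p K a • (hζ.toInteger : K) = ζ ^ (a : ZMod p).val := gal_apply_zeta hζ a
  rw [← e, smul_sub, smul_one]

/-- `σ_a` maps `∏_b σ_b(π)^{N_b}` to `∏_c σ_c(π)^{N(a⁻¹c)}`. [folklore] -/
theorem gal_smul_cycElt (a : (ZMod p)ˣ) (N : (ZMod p)ˣ → ℕ) :
    gal p K a • (∏ b, (gal p K b • (hζ.toInteger - 1)) ^ N b) =
      ∏ c, (gal p K c • (hζ.toInteger - 1)) ^ N (a⁻¹ * c) := by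
  rw [Finset.smul_prod']
  simp_rw [smul_pow', ← mul_smul, ← gal_mul]
  refine Fintype.prod_equiv (Equiv.mulLeft a) _ _ fun b => ?_
  simp only [Equiv.coe_mulLeft, inv_mul_cancel_left]

omit hq in
/-- `Sel` for cyclotomic elements is stable under `σ_a`. [cite: Schoof2009, Ch. 14 (`C^{(q)}` is a `ℤ[G]`-module)] -/
theorem sel_cycElt_comp {N : (ZMod p)ˣ → ℕ}
    (h : ∃ u c : 𝓞 K, IsCoprime c (q : 𝓞 K) ∧
      (q : 𝓞 K) ^ 2 ∣ (∏ b, (gal p K b • (hζ.toInteger - 1)) ^ N b) * c ^ q - u ^ q)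
    (a : (ZMod p)ˣ) :
    ∃ u c : 𝓞 K, IsCoprime c (q : 𝓞 K) ∧
      (q : 𝓞 K) ^ 2 ∣ (∏ b, (gal p K b • (hζ.toInteger - 1)) ^ N (a⁻¹ * b)) * c ^ q - u ^ q := by
  have := Sel.map (MulSemiringAction.toRingHom _ (𝓞 K) (gal p K a)) h
  rwa [MulSemiringAction.toRingHom_apply, gal_smul_cycElt] at this

/-- Products of cyclotomic units: `(∏ u^{N}) (∏ u^{N'}) = ∏ u^{N+N'}`. [folklore] -/
theorem cycUnit_mul (N N' : (ZMod p)ˣ → ℕ) :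
    (∏ a, uσ hζ a ^ N a) * (∏ a, uσ hζ a ^ N' a) = ∏ a, uσ hζ a ^ (N a + N' a) := by
  rw [← Finset.prod_mul_distrib]
  exact Finset.prod_congr rfl fun a _ => (pow_add _ _ _).symm

/-- Products of cyclotomic elements. [folklore] -/
theorem cycElt_mul (N N' : (ZMod p)ˣ → ℕ) :
    (∏ b, (gal p K b • (hζ.toInteger - 1)) ^ N b) * (∏ b, (gal p K b • (hζ.toInteger - 1)) ^ N' b) =
      ∏ b, (gal p K b • (hζ.toInteger - 1)) ^ (N b + N' b) := by
  rw [← Finset.prod_mul_distrib]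
  exact Finset.prod_congr rfl fun a _ => (pow_add _ _ _).symm

/-- Products of powers of reindexed cyclotomic units. [folklore] -/
theorem prod_cycUnit_pow {ι : Type*} (s : Finset ι) (M : ι → (ZMod p)ˣ → ℕ) (c : ι → ℕ) :
    ∏ i ∈ s, (∏ a, uσ hζ a ^ M i a) ^ c i = ∏ a, uσ hζ a ^ (∑ i ∈ s, c i * M i a) := by
  classical
  induction s using Finset.induction_on with
  | empty =>
    rw [Finset.prod_empty]
    simp_rw [Finset.sum_empty, pow_zero, Finset.prod_const_one]
  | insert j s hj ih =>
    rw [Finset.prod_insert hj, ih, ← Finset.prod_pow, ← Finset.prod_mul_distrib]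
    refine Finset.prod_congr rfl fun a _ => ?_
    rw [Finset.sum_insert hj, pow_add, ← pow_mul, mul_comm (M j a)]

/-- Products of powers of reindexed cyclotomic elements. [folklore] -/
theorem prod_cycElt_pow {ι : Type*} (s : Finset ι) (M : ι → (ZMod p)ˣ → ℕ) (c : ι → ℕ) :
    ∏ i ∈ s, (∏ b, (gal p K b • (hζ.toInteger - 1)) ^ M i b) ^ c i =
      ∏ b, (gal p K b • (hζ.toInteger - 1)) ^ (∑ i ∈ s, c i * M i b) := by
  classical
  induction s using Finset.induction_on with
  | empty =>
    rw [Finset.prod_empty]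
    simp_rw [Finset.sum_empty, pow_zero, Finset.prod_const_one]
  | insert j s hj ih =>
    rw [Finset.prod_insert hj, ih, ← Finset.prod_pow, ← Finset.prod_mul_distrib]
    refine Finset.prod_congr rfl fun a _ => ?_
    rw [Finset.sum_insert hj, pow_add, ← pow_mul, mul_comm (M j a)]

include hrep huniq hg hγ htoR in
/-- **Group-ring multiples of cyclotomic coordinates are cyclotomic coordinates**:
`f · toR (crd (∏ u^{N}, ∑ N)) = toR (crd (∏ u^{N'}, ∑ N'))` with
`N'(c) = ∑_k f_k N(γ^{-k} c)`; and `Sel` passes from `∏ σ_b(π)^{N_b}` to `∏ σ_b(π)^{N'_b}`.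
[cite: Schoof2009, Theorem 14.1 (proof: `CE^q/E^q` and `C^{(q)}E^q/E^q` are `𝔽_q[G⁺]`-submodules)] -/
theorem mul_toR_crd_cyc (hp2 : p ≠ 2) (hq2 : q ≠ 2) (hqp : q ≠ p)
    (f : MonoidAlgebra (ZMod q) (Multiplicative (ZMod g))) (N : (ZMod p)ˣ → ℕ) :
    f * toR (crd (∏ a, uσ hζ a ^ N a) (∑ a, (N a : ℤ))) =
      toR (crd (∏ a, uσ hζ a ^ (∑ k : ZMod g, (f.coeff (Multiplicative.ofAdd k)).val *
          N ((γ ^ k.val)⁻¹ * a)))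
        (∑ a, ((∑ k : ZMod g, (f.coeff (Multiplicative.ofAdd k)).val * N ((γ ^ k.val)⁻¹ * a) : ℕ) : ℤ))) ∧
    ((∃ u c : 𝓞 K, IsCoprime c (q : 𝓞 K) ∧
        (q : 𝓞 K) ^ 2 ∣ (∏ b, (gal p K b • (hζ.toInteger - 1)) ^ N b) * c ^ q - u ^ q) →
      ∃ u c : 𝓞 K, IsCoprime c (q : 𝓞 K) ∧ (q : 𝓞 K) ^ 2 ∣
        (∏ b, (gal p K b • (hζ.toInteger - 1)) ^ (∑ k : ZMod g, (f.coeff (Multiplicative.ofAdd k)).val *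
          N ((γ ^ k.val)⁻¹ * b))) * c ^ q - u ^ q) := by
  constructor
  · rw [mul_toR_crd hζ hrep huniq hg hγ toR htoR hp2 hq2 hqp]
    have hU : (∏ k : ZMod g, (unitsGal (gal p K (γ ^ k.val)) (∏ a, uσ hζ a ^ N a) *
        uσ hζ (γ ^ k.val) ^ (∑ a, (N a : ℤ))) ^ (f.coeff (Multiplicative.ofAdd k)).val) =
        ∏ k : ZMod g, (∏ c, uσ hζ c ^ N ((γ ^ k.val)⁻¹ * c)) ^ (f.coeff (Multiplicative.ofAdd k)).val :=
      Finset.prod_congr rfl fun k _ => by rw [unitsGal_cycUnit]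
    rw [hU, prod_cycUnit_pow]
    congr 2
    push_cast
    rw [Finset.sum_comm]
    refine Finset.sum_congr rfl fun k _ => ?_
    rw [← Finset.mul_sum, sum_comp_mul_inv]
  · intro h
    rw [← prod_cycElt_pow]
    exact Sel.prod _ fun k _ => Sel.pow (sel_cycElt_comp hζ h _) _

/-! ### The span `𝓒` and the ideal `𝓒_P` -/

include hrep huniq hg hγ htoR in
/-- **Elements of `𝓒 = A · {toR (crd (u_a, 1))}` are coordinates of cyclotomic pairs** (`CE^q/E^q` is
spanned over `𝔽_q[G⁺]` by the `ζ^a - 1`). [cite: Schoof2009, Theorem 14.1 (proof) and Exercise 14.4] -/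
theorem exists_cyc_of_mem_span (hp2 : p ≠ 2) (hq2 : q ≠ 2) (hqp : q ≠ p)
    {X : MonoidAlgebra (ZMod q) (Multiplicative (ZMod g))}
    (hX : X ∈ Ideal.span (Set.range fun a : (ZMod p)ˣ => toR (crd (uσ hζ a) 1))) :
    ∃ N : (ZMod p)ˣ → ℕ, X = toR (crd (∏ a, uσ hζ a ^ N a) (∑ a, (N a : ℤ))) := by
  classical
  induction hX using Submodule.span_induction with
  | mem x hx =>
    obtain ⟨a, rfl⟩ := hx
    refine ⟨Pi.single a 1, ?_⟩
    show toR (crd (uσ hζ a) 1) = _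
    congr 2
    · rw [Finset.prod_eq_single a (fun b _ hb => by rw [Pi.single_eq_of_ne hb, pow_zero])
        (fun h => absurd (Finset.mem_univ a) h), Pi.single_eq_same, pow_one]
    · rw [Finset.sum_eq_single a (fun b _ hb => by rw [Pi.single_eq_of_ne hb, Nat.cast_zero])
        (fun h => absurd (Finset.mem_univ a) h), Pi.single_eq_same, Nat.cast_one]
  | zero =>
    refine ⟨0, ?_⟩
    simp only [Pi.zero_apply, pow_zero, Finset.prod_const_one, Nat.cast_zero, Finset.sum_const_zero]
    rw [crd_one_zero hζ huniq, toR_zero toR htoR]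
  | add x y _ _ hx hy =>
    obtain ⟨N, rfl⟩ := hx
    obtain ⟨N', rfl⟩ := hy
    refine ⟨N + N', ?_⟩
    rw [← toR_add toR htoR, ← crd_mul hζ hrep huniq, cycUnit_mul]
    congr 2
    rw [← Finset.sum_add_distrib]
    rfl
  | smul r x _ hx =>
    obtain ⟨N, rfl⟩ := hx
    rw [smul_eq_mul]
    exact ⟨_, (mul_toR_crd_cyc hζ hrep huniq hg hγ toR htoR hp2 hq2 hqp r N).1⟩

include hrep huniq hg hγ htoR in
/-- **The coordinates of the `Sel` cyclotomic pairs form an ideal**: every element of their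
`A`-span is again of that form (`C^{(q)}E^q/E^q` is an `𝔽_q[G⁺]`-submodule).
[cite: Schoof2009, Theorem 14.1 (proof)] -/
theorem mem_of_mem_span_sel (hp2 : p ≠ 2) (hq2 : q ≠ 2) (hqp : q ≠ p)
    {X : MonoidAlgebra (ZMod q) (Multiplicative (ZMod g))}
    (hX : X ∈ Ideal.span {Y | ∃ N : (ZMod p)ˣ → ℕ,
      (∃ u c : 𝓞 K, IsCoprime c (q : 𝓞 K) ∧
        (q : 𝓞 K) ^ 2 ∣ (∏ b, (gal p K b • (hζ.toInteger - 1)) ^ N b) * c ^ q - u ^ q) ∧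
      Y = toR (crd (∏ a, uσ hζ a ^ N a) (∑ a, (N a : ℤ)))}) :
    ∃ N : (ZMod p)ˣ → ℕ,
      (∃ u c : 𝓞 K, IsCoprime c (q : 𝓞 K) ∧
        (q : 𝓞 K) ^ 2 ∣ (∏ b, (gal p K b • (hζ.toInteger - 1)) ^ N b) * c ^ q - u ^ q) ∧
      X = toR (crd (∏ a, uσ hζ a ^ N a) (∑ a, (N a : ℤ))) := by
  classical
  induction hX using Submodule.span_induction with
  | mem x hx => exact hx
  | zero =>
    refine ⟨0, ?_, ?_⟩
    · simp only [Pi.zero_apply, pow_zero, Finset.prod_const_one]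
      exact Sel.one q
    · simp only [Pi.zero_apply, pow_zero, Finset.prod_const_one, Nat.cast_zero, Finset.sum_const_zero]
      rw [crd_one_zero hζ huniq, toR_zero toR htoR]
  | add x y _ _ hx hy =>
    obtain ⟨N, hN, rfl⟩ := hx
    obtain ⟨N', hN', rfl⟩ := hy
    refine ⟨N + N', ?_, ?_⟩
    · have := Sel.mul hN hN'
      rw [cycElt_mul] at this
      exact this
    · rw [← toR_add toR htoR, ← crd_mul hζ hrep huniq, cycUnit_mul]
      congr 2
      rw [← Finset.sum_add_distrib]
      rfl
  | smul r x _ hx =>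
    obtain ⟨N, hN, rfl⟩ := hx
    have h := mul_toR_crd_cyc hζ hrep huniq hg hγ toR htoR hp2 hq2 hqp r N
    rw [smul_eq_mul]
    exact ⟨_, h.2 hN, h.1⟩

/-! ### `Sel` and `q`-th powers of `p`-units -/

omit hK in
/-- `π = ζ - 1` is prime to `q` (for `p ≠ q`): `π ∣ p` and `p, q` are coprime integers. [folklore] -/
theorem isCoprime_pi_natCast {q : ℕ} (hq : q.Prime) (hpq : p ≠ q) :
    IsCoprime (hζ.toInteger - 1) (q : 𝓞 K) := by
  have hcop : IsCoprime (p : 𝓞 K) (q : 𝓞 K) := by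
    have h := (Nat.coprime_primes hp.out hq).mpr hpq
    rw [← Nat.isCoprime_iff_coprime] at h
    simpa using h.map (Int.castRingHom (𝓞 K))
  refine hcop.of_isCoprime_of_dvd_left ?_
  -- `ζ - 1 ∣ p` in `𝓞 K`
  rw [← prod_Ico_one_sub_zeta_pow hζ]
  have hp1 : 1 ∈ Ico 1 p := Finset.mem_Ico.mpr ⟨le_refl 1, hp.out.one_lt⟩
  refine dvd_trans ?_ (Finset.dvd_prod_of_mem (fun i => 1 - hζ.toInteger ^ i) hp1)
  have e : (1 : 𝓞 K) - hζ.toInteger ^ 1 = -(hζ.toInteger - 1) := by rw [pow_one, neg_sub]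
  rw [e]
  exact dvd_neg.mpr (dvd_refl _)

omit [NumberField K] hK in
/-- Units are prime to everything. [folklore] -/
theorem isCoprime_unit (u : (𝓞 K)ˣ) (y : 𝓞 K) : IsCoprime (u : 𝓞 K) y :=
  ⟨((u⁻¹ : (𝓞 K)ˣ) : 𝓞 K), 0, by rw [zero_mul, add_zero, Units.inv_mul]⟩

omit [NumberField K] hK in
/-- The element `ε π^m` (`m ∈ ℕ`) of `𝓞 K`, in `K`. [folklore] -/
theorem coe_unit_mul_pi_pow (ε : (𝓞 K)ˣ) (m : ℕ) :
    ((((ε : 𝓞 K) * (hζ.toInteger - 1) ^ m : 𝓞 K)) : K) = punit hζ ε (m : ℤ) := by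
  unfold punit
  push_cast
  rw [zpow_natCast]

/-- **`Sel` passes between integral `p`-units which differ by the `q`-th power of a `p`-unit**:
if `ε π^m = ε' π^{m'} · (δ π^n)^q` in `K` (`m, m' ≥ 0`, `n ∈ ℤ`) and `ε' π^{m'}` is a `q`-th power
modulo `q²` up to `q`-units, so is `ε π^m` (if `n ≥ 0` multiply by the integral `(δ π^n)^q`,
otherwise divide: `ε' π^{m'} = ε π^m (δ⁻¹ π^{-n})^q`). [cite: Schoof2009, Ch. 14 (proof of Theorem 14.1: `E^{(q)} ∩ CE^q = C^{(q)}E^q`)] -/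
theorem sel_of_punit_eq_mul_pow {q : ℕ} (hq : q.Prime) (hpq : p ≠ q) {ε ε' δ : (𝓞 K)ˣ} {m m' : ℕ}
    {n : ℤ} (h : punit hζ ε (m : ℤ) = punit hζ ε' (m' : ℤ) * punit hζ δ n ^ q)
    (hsel : ∃ u c : 𝓞 K, IsCoprime c (q : 𝓞 K) ∧
      (q : 𝓞 K) ^ 2 ∣ ((ε' : 𝓞 K) * (hζ.toInteger - 1) ^ m') * c ^ q - u ^ q) :
    ∃ u c : 𝓞 K, IsCoprime c (q : 𝓞 K) ∧
      (q : 𝓞 K) ^ 2 ∣ ((ε : 𝓞 K) * (hζ.toInteger - 1) ^ m) * c ^ q - u ^ q := by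
  have hπq := isCoprime_pi_natCast hζ hq hpq
  rcases le_or_gt 0 n with hn | hn
  · -- `n ≥ 0`: `ε π^m = ε' π^{m'} (δ π^n)^q` in `𝓞 K`
    obtain ⟨n, rfl⟩ := Int.eq_ofNat_of_zero_le hn
    have hO : (ε : 𝓞 K) * (hζ.toInteger - 1) ^ m =
        ((ε' : 𝓞 K) * (hζ.toInteger - 1) ^ m') * ((δ : 𝓞 K) * (hζ.toInteger - 1) ^ n) ^ q := by
      apply FaithfulSMul.algebraMap_injective (𝓞 K) K
      push_cast
      have h' := h
      rw [← coe_unit_mul_pi_pow, ← coe_unit_mul_pi_pow, ← coe_unit_mul_pi_pow] at h'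
      exact_mod_cast h'
    rw [hO]
    exact Sel.mul_pow_of _ hsel
  · -- `n < 0`: `ε' π^{m'} = ε π^m (δ⁻¹ π^{-n})^q`
    obtain ⟨n', hn'⟩ : ∃ n' : ℕ, n = -(n' : ℤ) := ⟨(-n).toNat, by omega⟩
    have hO : (ε' : 𝓞 K) * (hζ.toInteger - 1) ^ m' =
        ((ε : 𝓞 K) * (hζ.toInteger - 1) ^ m) * (((δ⁻¹ : (𝓞 K)ˣ) : 𝓞 K) * (hζ.toInteger - 1) ^ n') ^ q := by
      have h' : punit hζ ε' (m' : ℤ) = punit hζ ε (m : ℤ) * punit hζ δ⁻¹ (n' : ℤ) ^ q := by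
        rw [h, hn', mul_assoc, ← mul_pow, ← punit_mul, mul_inv_cancel, neg_add_cancel]
        have h1 : punit hζ (1 : (𝓞 K)ˣ) 0 = 1 := by unfold punit; simp
        rw [h1, one_pow, mul_one]
      rw [← coe_unit_mul_pi_pow, ← coe_unit_mul_pi_pow, ← coe_unit_mul_pi_pow] at h'
      apply FaithfulSMul.algebraMap_injective (𝓞 K) K
      push_cast
      exact_mod_cast h'
    rw [hO] at hsel
    refine Sel.of_mul_pow ?_ hsel
    exact (isCoprime_unit _ _).mul_left (hπq.pow_left)

end Catalan.PlusIdeals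

end Literature.NumberTheory.DiophantineGeometry
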